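import Mathlib.GroupTheory.Index
import Mathlib.GroupTheory.GroupAction.Defs
import HarnessLib

/-!
# The abstract torsor count: the image of a coset `g₀·C` in `U ⧸ R` has `[C : C ∩ R]` elements; a `C`-orbit whose lattice map has `R`-cosets as fibres has `[C : R]` images
# (Serre, *Trees*, I §1.1 ∕ Jacobowitz 1962 §7: counting lattices of an order as a units-torsor)

Topic `GroupTheory`; namespace `Literature.GroupTheory`.  THEOREMS ONLY (no definition, no instance, no notation, no named fact, no `sorry`); Mathlib-only imports.
Road «S3-tree» of cell `pub/hodgecm-mathlib` (crux H413 = `stmt-HodgeConjecture-24833`), T3′ population P-2 (architect A-82 (2), census F0P3a-p04 (g16) addendum 1bdd60a2 §(C)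
«(c1) the ABSTRACT TORSOR count (group theory: `U` commutative, `R ≤ C ≤ U`, `G = g₀·C` ⇒ `#(image of G in U ⧸ R) = [C : R]`) — population-blind, serves P-2∕P-3»); organ by
F0P3-p03 (g13).  It is the carrier-free skeleton of the last forty lines of ★ O8a-1 `SplitTorusOrderSelfDualTorsor.natCard_setOf_cyclicLattice_good_eq_relIndex` (F0P3b-p01 (g11),
split form `Fin n → K`): there the GOOD vectors form ONE orbit of `C = {c : N(c) ∈ R^×}` and the cyclic lattices `O[γ]·a`, `O[γ]·a′` of two good vectors coincide iff `a′ ∈ R^×·a`;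
here `U`, `C`, `R`, the orbit and the lattice map are ABSTRACT, so the type-(2) population (operator currency `U = (L_w[γ′])^×`, no eigenframe) instantiates the same count.
HONEST LABEL: HC_CM is proved only modulo the printed citations (2 remaining named inputs hLiu418, h413) until rung 0 closes; pure group theory, pays no letter.

THE MATHEMATICS.  `U` a group, `C R ≤ U` subgroups (no normality, no `R ≤ C`: `[C : R]` means `R.relIndex C = [C : C ∩ R]`, `= 0` if infinite).  (§1) For a map `f : C → Y` whose
fibres are the left cosets of `C ∩ R` (`f c = f c′ ↔ c⁻¹c′ ∈ R`), `Nat.card (range f) = [C : R]` (`range f ≃ C ⧸ (R ⊓ C)` via `Setoid.quotientKerEquivRange`).  (§2) The image of the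
coset `g₀·C` in `U ⧸ R` (left cosets): `c ↦ (g₀c)R` has exactly these fibres (`(g₀c)⁻¹(g₀c′) = c⁻¹c′`), so **`#{(g₀c)R : c ∈ C} = [C : R]`** — for commutative `U` this is the §(C) text
verbatim.  (§3) ACTION FORM used by the lattice counts: `U` acts on `X`, `Good ⊆ X` is a single `C`-orbit (`a₀ ∈ Good`, `C`-stable, `C`-transitive) and `Lat : X → Y` has
`Lat (c•a₀) = Lat (c′•a₀) ↔ c⁻¹c′ ∈ R` on `C`; then **`Nat.card {M | ∃ a ∈ Good, M = Lat a} = [C : R]`**.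

## References
* [Serre1980Trees] J.-P. Serre, *Trees* (1980): Ch. II §1.1 (lattices and their classes; counting via stabilisers ∕ cosets).
* [Jacobowitz1962] R. Jacobowitz, *Hermitian forms over local fields*, Amer. J. Math. 84 (1962): §7 (lattices of a given type as a torsor under units).
-/

set_option autoImplicit false

namespace Literature.GroupTheory

/-! ## §1 Maps with coset fibres -/

/-- **A map on `C` whose fibres are the left cosets of `C ∩ R` has `[C : R]` values**: `(∀ c c′, f c = f c′ ↔ c⁻¹ * c′ ∈ R) → Nat.card (range f) = R.relIndex C`.
[cite: Serre1980Trees, Ch. II §1.1] -/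
theorem natCard_range_eq_relIndex_of_fibres {U Y : Type*} [Group U] (C R : Subgroup U) (f : C → Y)
    (hf : ∀ c c' : C, f c = f c' ↔ ((c : U))⁻¹ * (c' : U) ∈ R) :
    Nat.card (Set.range f) = R.relIndex C := by
  classical
  have hker : Setoid.ker f = QuotientGroup.leftRel (R.subgroupOf C) := by
    ext a b
    rw [Setoid.ker_def, QuotientGroup.leftRel_apply, Subgroup.mem_subgroupOf, Subgroup.coe_mul, Subgroup.coe_inv]
    exact hf a b
  rw [Subgroup.relIndex, Subgroup.index, ← Nat.card_congr (Setoid.quotientKerEquivRange f), hker]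
  rfl

/-! ## §2 The image of a coset in `U ⧸ R` -/

/-- **`#{(g₀·c)R : c ∈ C} = [C : R]`** — the image of the coset `g₀·C` in the left-coset space `U ⧸ R` has `R.relIndex C = [C : C ∩ R]` elements (for commutative `U` and
`R ≤ C ≤ U`: «`G = g₀·C ⇒ #(image of G in U ⧸ R) = [C : R]`»). [cite: Serre1980Trees, Ch. II §1.1] [cite: Jacobowitz1962, §7] -/
theorem natCard_image_coset_eq_relIndex {U : Type*} [Group U] (C R : Subgroup U) (g₀ : U) :
    Nat.card {x : U ⧸ R // ∃ c : U, c ∈ C ∧ x = ((g₀ * c : U) : U ⧸ R)} = R.relIndex C := by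
  have hrange : Set.range (fun c : C => ((g₀ * (c : U) : U) : U ⧸ R)) = {x : U ⧸ R | ∃ c : U, c ∈ C ∧ x = ((g₀ * c : U) : U ⧸ R)} := by
    ext x
    constructor
    · rintro ⟨c, rfl⟩; exact ⟨c, c.2, rfl⟩
    · rintro ⟨c, hc, rfl⟩; exact ⟨⟨c, hc⟩, rfl⟩
  rw [← Set.coe_setOf, ← hrange]
  refine natCard_range_eq_relIndex_of_fibres C R _ fun c c' => ?_
  rw [QuotientGroup.eq, mul_inv_rev, mul_assoc, inv_mul_cancel_left]

/-! ## §3 The action form: a single `C`-orbit whose lattice map has `R`-cosets as fibres -/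

/-- **THE TORSOR COUNT (action form)**: `U` acts on `X`; `Good ⊆ X` is ONE `C`-orbit (`a₀ ∈ Good`; `c • a ∈ Good` for `c ∈ C`, `a ∈ Good`; any two good points differ by some
`c ∈ C`); `Lat : X → Y` satisfies `Lat (c • a₀) = Lat (c′ • a₀) ↔ c⁻¹c′ ∈ R` for `c, c′ ∈ C`.  Then `Nat.card {M // ∃ a ∈ Good, M = Lat a} = R.relIndex C` — the count of the
lattices `R·a` of the good vectors `a` in ★ O8a-1, with carrier, norm map and criterion abstracted away. [cite: Jacobowitz1962, §7] [cite: Serre1980Trees, Ch. II §1.1] -/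
theorem natCard_setOf_image_orbit_eq_relIndex {U X Y : Type*} [Group U] [MulAction U X] (C R : Subgroup U) (Good : Set X) (a₀ : X) (ha₀ : a₀ ∈ Good)
    (hstab : ∀ c ∈ C, ∀ a ∈ Good, c • a ∈ Good) (htrans : ∀ a ∈ Good, ∀ a' ∈ Good, ∃ c ∈ C, c • a = a')
    (Lat : X → Y) (hfib : ∀ c ∈ C, ∀ c' ∈ C, Lat (c • a₀) = Lat (c' • a₀) ↔ c⁻¹ * c' ∈ R) :
    Nat.card {M : Y // ∃ a ∈ Good, M = Lat a} = R.relIndex C := by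
  have hrange : Set.range (fun c : C => Lat ((c : U) • a₀)) = {M : Y | ∃ a ∈ Good, M = Lat a} := by
    ext M
    constructor
    · rintro ⟨c, rfl⟩; exact ⟨(c : U) • a₀, hstab c c.2 a₀ ha₀, rfl⟩
    · rintro ⟨a, ha, rfl⟩
      obtain ⟨c, hc, hca⟩ := htrans a₀ ha₀ a ha
      exact ⟨⟨c, hc⟩, by simp only [hca]⟩
  rw [← Set.coe_setOf, ← hrange]
  exact natCard_range_eq_relIndex_of_fibres C R _ fun c c' => hfib c c.2 c' c'.2

/-- **Variant with the orbit presented as `C • a₀`**: `Nat.card {M // ∃ c ∈ C, M = Lat (c • a₀)} = R.relIndex C` under the fibre hypothesis alone. [cite: Jacobowitz1962, §7] -/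
theorem natCard_setOf_lat_smul_eq_relIndex {U X Y : Type*} [Group U] [MulAction U X] (C R : Subgroup U) (a₀ : X)
    (Lat : X → Y) (hfib : ∀ c ∈ C, ∀ c' ∈ C, Lat (c • a₀) = Lat (c' • a₀) ↔ c⁻¹ * c' ∈ R) :
    Nat.card {M : Y // ∃ c ∈ C, M = Lat (c • a₀)} = R.relIndex C := by
  have hrange : Set.range (fun c : C => Lat ((c : U) • a₀)) = {M : Y | ∃ c ∈ C, M = Lat (c • a₀)} := by
    ext M
    constructor
    · rintro ⟨c, rfl⟩; exact ⟨c, c.2, rfl⟩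
    · rintro ⟨c, hc, rfl⟩; exact ⟨⟨c, hc⟩, rfl⟩
  rw [← Set.coe_setOf, ← hrange]
  exact natCard_range_eq_relIndex_of_fibres C R _ fun c c' => hfib c c.2 c' c'.2

end Literature.GroupTheory
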